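import Mathlib
import HarnessLib

/-!
# Classes in `ℚθ³ ⊕ W` are killed by no interior product: the monomial-support core of LEMMA W (i)
# (WEIL-2 gen 26, STABILIZERS-G26 §3.1)

research route, not a corollary; conditional on HC_CM plus one named minimal statement.

Cell `pub-hodge-ring2-ab-*` (ALL ABELIAN VARIETIES), seat WEIL-2 gen 26, §3.1 / §6 of
`run/shared/lean/pub/pub-hodge-ring2/pub-hodge-ring2-ab-weil-2/STABILIZERS-G26.md`.

Informal setting (not formalised).  On `Y₀ = E_ω⁶` write `H⁶(Y₀, ℂ) = ⊕ ℂ·e_I f_J` over pairs of index sets with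
`|I| + |J| = 6` (`e_i = dz_i`, `f_j = dz̄_j`), `+ = {0,1,2}`, `− = {3,4,5}`.  The classes that stay Hodge on the very general member of
the Weil family are `R_ns = ℚθ³ ⊕ W` with `θ³ = Σ_{|I|=3} δ_I e_I f_I` (`δ_I ≠ 0`) and `W_ℂ = ℂ w₊ ⊕ ℂ w₋`, `w₊ = e₊ f₋`, `w₋ = e₋ f₊`.
The interior product with a tangent vector `v` is `ι_v (e_I f_J) = Σ_{i∈I} ±v_i e_{I∖i} f_J`.  LEMMA W (i) of the account says:
`ι_v(λθ³ + a w₊ + b w₋) = 0` forces `λ v = 0`, `a v₊ = 0`, `b v₋ = 0` — because the three families of monomials produced have pairwise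
different SHAPES (`(I∖m, I)`, `(+∖i, −)`, `(−∖j, +)`), and each monomial has a single source.  Consequence (COROLLARY W): a closed subscheme
of `Y₀` whose class lies in `R_ns ∖ 0` is invariant under no positive-dimensional sub-torus (an `E_v`-invariant cycle has class pulled
back from `Y₀/E_v`, hence killed by `ι_v`).

What is proved here is exactly that support argument, with every piece of data that does not matter made ARBITRARY: any index type,
two disjoint blocks `P`, `N` with at least two elements each (the `±` blocks), any finite family `S` of «diagonal» index sets carrying
`θ³` with non-zero coefficients `δ`, arbitrary non-zero sign factors `ε I i` in the contraction, any field.  Vectors of `H⁶` are finitely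
supported functions on pairs of finsets, and the contraction is written out as a sum of `Finsupp.single`s in each statement (no `def`).

* `contract_apply_theta_key`, `contract_apply_wplus_key`, `contract_apply_offblock_key`, `contract_apply_self_key` — the
  single-source coefficient computations;
* `lemmaW_contract` — vanishing of the contraction of `λ•θ³ + a•w₊ + b•w₋` forces `λ·v_m = 0` on `⋃ S`, `a·v_i = 0` on `P`,
  `b·v_j = 0` on `N`;
* `eq_zero_of_contract_weilClass_eq_zero` — with `a ≠ 0`, `b ≠ 0`: `v` vanishes on `P ∪ N` (LEMMA W (i) for a genuine Weil class);
* `fin6_eq_zero_of_contract_weilClass_eq_zero` — the instance `P = {0,1,2}`, `N = {3,4,5}` of the account: `v = 0`.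

The mirror statement LEMMA W (ii) (wedge with a covector; COROLLARY W (b): unconfined) is the sibling file
`Ring2AbelianAllNonsplitWeilClassConfinement`.

0 sorry, no `def`, no named fact; `HC_CM` does not occur.
-/

namespace Summit.HodgeConjecture.Ring2AbelianAll.NonsplitWeilClassSupport

open Finsupp BigOperators

variable {ι : Type*} [DecidableEq ι] {L : Type*} [Field L]

/-- Key fact 1 (θ-shapes): for `m ∈ I`, the coefficient of the monomial `(I.erase m, I)` in the contraction of a diagonal monomial
`(I', I')` is `c * ε I m * v m` if `I' = I` (single source `i = m`) and `0` otherwise.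
research route, not a corollary; conditional on HC_CM plus one named minimal statement. [locator STABILIZERS-G26 §3.1] -/
theorem contract_apply_theta_key (ε : Finset ι → ι → L) (v : ι → L) (I I' : Finset ι) {m : ι} (hm : m ∈ I) (c : L) :
    (∑ i ∈ I', (c * ε I' i * v i) • Finsupp.single (I'.erase i, I') (1 : L)) (I.erase m, I)
      = if I' = I then c * ε I m * v m else 0 := by
  rw [Finsupp.finsetSum_apply]
  split_ifs with h
  · subst h
    rw [Finset.sum_eq_single m]
    · simp
    · intro i _ him
      rw [Finsupp.smul_apply, Finsupp.single_apply, if_neg, smul_zero]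
      intro heq
      apply him
      have h1 : I'.erase i = I'.erase m := congrArg Prod.fst heq
      by_contra hne
      have : m ∈ I'.erase i := Finset.mem_erase.2 ⟨fun h => hne h.symm, hm⟩
      rw [h1] at this
      exact Finset.notMem_erase m I' this
    · intro hm'; exact absurd hm hm'
  · apply Finset.sum_eq_zero
    intro i _
    rw [Finsupp.smul_apply, Finsupp.single_apply, if_neg, smul_zero]
    intro heq
    exact h (congrArg Prod.snd heq)

/-- Key fact 2 (a block shape against θ-shapes): if `P` and `N` are disjoint and `P.erase i` is non-empty, the monomial `(P.erase i, N)`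
does not occur in the contraction of any diagonal monomial `(I', I')`.
research route, not a corollary; conditional on HC_CM plus one named minimal statement. [locator STABILIZERS-G26 §3.1] -/
theorem contract_apply_wplus_key (ε : Finset ι → ι → L) (v : ι → L) {P N : Finset ι} (hPN : Disjoint P N)
    (I' : Finset ι) {i : ι} (hne : (P.erase i).Nonempty) (c : L) :
    (∑ i' ∈ I', (c * ε I' i' * v i') • Finsupp.single (I'.erase i', I') (1 : L)) (P.erase i, N) = 0 := by
  rw [Finsupp.finsetSum_apply]
  apply Finset.sum_eq_zero
  intro i' _
  rw [Finsupp.smul_apply, Finsupp.single_apply, if_neg, smul_zero]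
  intro heq
  have h1 : I'.erase i' = P.erase i := congrArg Prod.fst heq
  have h2 : I' = N := congrArg Prod.snd heq
  obtain ⟨x, hx⟩ := hne
  have hxP : x ∈ P := Finset.mem_of_mem_erase hx
  have hxN : x ∈ N := by
    rw [← h2]; exact Finset.mem_of_mem_erase (h1 ▸ hx)
  exact Finset.disjoint_left.1 hPN hxP hxN

/-- Key fact 3 (different second component): the coefficient of `(Q, N)` in the contraction of a monomial `(A, B)` with `B ≠ N`
is `0`.
research route, not a corollary; conditional on HC_CM plus one named minimal statement. [locator STABILIZERS-G26 §3.1] -/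
theorem contract_apply_offblock_key (ε : Finset ι → ι → L) (v : ι → L) {N A B : Finset ι} (hB : B ≠ N) (Q : Finset ι)
    (c : L) :
    (∑ i' ∈ A, (c * ε A i' * v i') • Finsupp.single (A.erase i', B) (1 : L)) (Q, N) = 0 := by
  rw [Finsupp.finsetSum_apply]
  apply Finset.sum_eq_zero
  intro i' _
  rw [Finsupp.smul_apply, Finsupp.single_apply, if_neg, smul_zero]
  intro heq
  exact hB (congrArg Prod.snd heq)

/-- Key fact 4 (single source inside a block): for `i ∈ P` the coefficient of `(P.erase i, N)` in the contraction of `(P, N)` is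
`c * ε P i * v i`.
research route, not a corollary; conditional on HC_CM plus one named minimal statement. [locator STABILIZERS-G26 §3.1] -/
theorem contract_apply_self_key (ε : Finset ι → ι → L) (v : ι → L) (P N : Finset ι) {i : ι} (hi : i ∈ P) (c : L) :
    (∑ i' ∈ P, (c * ε P i' * v i') • Finsupp.single (P.erase i', N) (1 : L)) (P.erase i, N) = c * ε P i * v i := by
  rw [Finsupp.finsetSum_apply, Finset.sum_eq_single i]
  · simp
  · intro i' _ hne
    rw [Finsupp.smul_apply, Finsupp.single_apply, if_neg, smul_zero]
    intro heq
    apply hne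
    have h1 : P.erase i' = P.erase i := congrArg Prod.fst heq
    by_contra hne'
    have : i ∈ P.erase i' := Finset.mem_erase.2 ⟨fun h => hne' h.symm, hi⟩
    rw [h1] at this
    exact Finset.notMem_erase i P this
  · intro hi'; exact absurd hi hi'

/-- **LEMMA W (i), monomial-support core.**  Blocks `P`, `N` disjoint with at least two elements each; `S` any finite family of index
sets (the support of `θ³`, coefficients `δ I ≠ 0`); sign factors `ε I i ≠ 0`.  If the contraction along `v` of
`λ•θ³ + a•w₊ + b•w₋` vanishes, then `λ * v m = 0` for every `m` in a member of `S`, `a * v i = 0` for every `i ∈ P`, and `b * v j = 0`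
for every `j ∈ N`.
research route, not a corollary; conditional on HC_CM plus one named minimal statement. [locator STABILIZERS-G26 §3.1 LEMMA W] -/
theorem lemmaW_contract {P N : Finset ι} (hPN : Disjoint P N) (hP : 1 < P.card) (hN : 1 < N.card)
    (S : Finset (Finset ι)) (δ : Finset ι → L) (hδ : ∀ I ∈ S, δ I ≠ 0)
    (ε : Finset ι → ι → L) (hε : ∀ I i, ε I i ≠ 0) (v : ι → L) (lam a b : L)
    (h0 : (∑ I ∈ S, ∑ i ∈ I, ((lam * δ I) * ε I i * v i) • Finsupp.single (I.erase i, I) (1 : L))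
          + (∑ i ∈ P, (a * ε P i * v i) • Finsupp.single (P.erase i, N) (1 : L))
          + (∑ j ∈ N, (b * ε N j * v j) • Finsupp.single (N.erase j, P) (1 : L)) = 0) :
    (∀ I ∈ S, ∀ m ∈ I, lam * v m = 0) ∧ (∀ i ∈ P, a * v i = 0) ∧ (∀ j ∈ N, b * v j = 0) := by
  have hPN' : P ≠ N := by
    intro h; subst h
    have : P = ∅ := (Finset.disjoint_self_iff_empty P).1 hPN
    subst this; simp at hP
  have hNP : Disjoint N P := hPN.symm
  have hPe : ∀ i, (P.erase i).Nonempty := fun i =>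
    Finset.card_pos.1 (lt_of_lt_of_le (by omega) (Finset.pred_card_le_card_erase))
  have hNe : ∀ j, (N.erase j).Nonempty := fun j =>
    Finset.card_pos.1 (lt_of_lt_of_le (by omega) (Finset.pred_card_le_card_erase))
  refine ⟨?_, ?_, ?_⟩
  · -- θ part: evaluate at the key (I.erase m, I)
    intro I hI m hm
    have h := congrArg (fun x => x (I.erase m, I)) h0
    simp only [Finsupp.add_apply, Finsupp.zero_apply] at h
    have hθ : (∑ I' ∈ S, ∑ i ∈ I', ((lam * δ I') * ε I' i * v i) • Finsupp.single (I'.erase i, I') (1 : L))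
        (I.erase m, I) = lam * δ I * ε I m * v m := by
      rw [Finsupp.finsetSum_apply, Finset.sum_eq_single I]
      · rw [contract_apply_theta_key ε v I I hm, if_pos rfl]
      · intro I' _ hne
        rw [contract_apply_theta_key ε v I I' hm, if_neg hne]
      · intro hI'; exact absurd hI hI'
    have hwp : (∑ i ∈ P, (a * ε P i * v i) • Finsupp.single (P.erase i, N) (1 : L)) (I.erase m, I) = 0 := by
      rw [Finsupp.finsetSum_apply]
      apply Finset.sum_eq_zero
      intro i _
      rw [Finsupp.smul_apply, Finsupp.single_apply, if_neg, smul_zero]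
      intro heq
      have h1 : P.erase i = I.erase m := congrArg Prod.fst heq
      have h2 : N = I := congrArg Prod.snd heq
      obtain ⟨x, hx⟩ := hPe i
      have hxP : x ∈ P := Finset.mem_of_mem_erase hx
      have hxN : x ∈ N := by rw [h2]; exact Finset.mem_of_mem_erase (h1 ▸ hx)
      exact Finset.disjoint_left.1 hPN hxP hxN
    have hwm : (∑ j ∈ N, (b * ε N j * v j) • Finsupp.single (N.erase j, P) (1 : L)) (I.erase m, I) = 0 := by
      rw [Finsupp.finsetSum_apply]
      apply Finset.sum_eq_zero
      intro j _
      rw [Finsupp.smul_apply, Finsupp.single_apply, if_neg, smul_zero]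
      intro heq
      have h1 : N.erase j = I.erase m := congrArg Prod.fst heq
      have h2 : P = I := congrArg Prod.snd heq
      obtain ⟨x, hx⟩ := hNe j
      have hxN : x ∈ N := Finset.mem_of_mem_erase hx
      have hxP : x ∈ P := by rw [h2]; exact Finset.mem_of_mem_erase (h1 ▸ hx)
      exact Finset.disjoint_left.1 hPN hxP hxN
    rw [hθ, hwp, hwm, add_zero, add_zero] at h
    have : lam * v m * (δ I * ε I m) = 0 := by rw [← h]; ring
    rcases mul_eq_zero.1 this with h' | h'
    · exact h'
    · exact absurd h' (mul_ne_zero (hδ I hI) (hε I m))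
  · -- w₊ part: evaluate at (P.erase i, N)
    intro i hi
    have h := congrArg (fun x => x (P.erase i, N)) h0
    simp only [Finsupp.add_apply, Finsupp.zero_apply] at h
    have hθ : (∑ I' ∈ S, ∑ i' ∈ I', ((lam * δ I') * ε I' i' * v i') • Finsupp.single (I'.erase i', I') (1 : L))
        (P.erase i, N) = 0 := by
      rw [Finsupp.finsetSum_apply]
      apply Finset.sum_eq_zero
      intro I' _
      exact contract_apply_wplus_key ε v hPN I' (hPe i) (lam * δ I')
    have hwp := contract_apply_self_key ε v P N hi a
    have hwm : (∑ j ∈ N, (b * ε N j * v j) • Finsupp.single (N.erase j, P) (1 : L)) (P.erase i, N) = 0 :=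
      contract_apply_offblock_key ε v hPN' (P.erase i) b
    rw [hθ, hwp, hwm, zero_add, add_zero] at h
    have : a * v i * ε P i = 0 := by rw [← h]; ring
    rcases mul_eq_zero.1 this with h' | h'
    · exact h'
    · exact absurd h' (hε P i)
  · -- w₋ part: evaluate at (N.erase j, P)
    intro j hj
    have h := congrArg (fun x => x (N.erase j, P)) h0
    simp only [Finsupp.add_apply, Finsupp.zero_apply] at h
    have hθ : (∑ I' ∈ S, ∑ i' ∈ I', ((lam * δ I') * ε I' i' * v i') • Finsupp.single (I'.erase i', I') (1 : L))
        (N.erase j, P) = 0 := by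
      rw [Finsupp.finsetSum_apply]
      apply Finset.sum_eq_zero
      intro I' _
      exact contract_apply_wplus_key ε v hNP I' (hNe j) (lam * δ I')
    have hwp : (∑ i ∈ P, (a * ε P i * v i) • Finsupp.single (P.erase i, N) (1 : L)) (N.erase j, P) = 0 :=
      contract_apply_offblock_key ε v (Ne.symm hPN') (N.erase j) a
    have hwm := contract_apply_self_key ε v N P hj b
    rw [hθ, hwp, hwm, zero_add, zero_add] at h
    have : b * v j * ε N j = 0 := by rw [← h]; ring
    rcases mul_eq_zero.1 this with h' | h'
    · exact h'
    · exact absurd h' (hε N j)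

/-- **LEMMA W (i) for a genuine Weil class** (`a ≠ 0 ≠ b`: a non-zero REAL element of `W` has both components): if the contraction of
`λ•θ³ + a•w₊ + b•w₋` along `v` vanishes then `v` vanishes on both blocks — in the account: a cycle of class `λθ³ + w`, `w ≠ 0`, is
invariant under no `E_v`, `v ≠ 0` (COROLLARY W (a): finite stabilizer).
research route, not a corollary; conditional on HC_CM plus one named minimal statement. [locator STABILIZERS-G26 §3.2 COROLLARY W] -/
theorem eq_zero_of_contract_weilClass_eq_zero {P N : Finset ι} (hPN : Disjoint P N) (hP : 1 < P.card) (hN : 1 < N.card)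
    (S : Finset (Finset ι)) (δ : Finset ι → L) (hδ : ∀ I ∈ S, δ I ≠ 0)
    (ε : Finset ι → ι → L) (hε : ∀ I i, ε I i ≠ 0) (v : ι → L) (lam a b : L) (ha : a ≠ 0) (hb : b ≠ 0)
    (h0 : (∑ I ∈ S, ∑ i ∈ I, ((lam * δ I) * ε I i * v i) • Finsupp.single (I.erase i, I) (1 : L))
          + (∑ i ∈ P, (a * ε P i * v i) • Finsupp.single (P.erase i, N) (1 : L))
          + (∑ j ∈ N, (b * ε N j * v j) • Finsupp.single (N.erase j, P) (1 : L)) = 0) :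
    ∀ i ∈ P ∪ N, v i = 0 := by
  obtain ⟨-, hp, hm2⟩ := lemmaW_contract hPN hP hN S δ hδ ε hε v lam a b h0
  intro i hi
  rcases Finset.mem_union.1 hi with hiP | hiN
  · exact (mul_eq_zero.1 (hp i hiP)).resolve_left ha
  · exact (mul_eq_zero.1 (hm2 i hiN)).resolve_left hb

/-- The account's instance: `ι = Fin 6`, `P = {0,1,2}`, `N = {3,4,5}` (so `P ∪ N` is everything and `v = 0`), `S` any family of
index sets carrying `θ³` with non-zero coefficients (the cell's `6 d_i d_j d_k` or the split sibling's), any non-zero signs: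
a Weil class `λθ³ + a w₊ + b w₋` (`a, b ≠ 0`) is killed by `ι_v` only for `v = 0`.
research route, not a corollary; conditional on HC_CM plus one named minimal statement. [locator STABILIZERS-G26 §3.1] -/
theorem fin6_eq_zero_of_contract_weilClass_eq_zero
    (S : Finset (Finset (Fin 6))) (δ : Finset (Fin 6) → L) (hδ : ∀ I ∈ S, δ I ≠ 0)
    (ε : Finset (Fin 6) → Fin 6 → L) (hε : ∀ I i, ε I i ≠ 0) (v : Fin 6 → L) (lam a b : L) (ha : a ≠ 0) (hb : b ≠ 0)
    (h0 : (∑ I ∈ S, ∑ i ∈ I, ((lam * δ I) * ε I i * v i) • Finsupp.single (I.erase i, I) (1 : L))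
          + (∑ i ∈ ({0, 1, 2} : Finset (Fin 6)), (a * ε {0, 1, 2} i * v i) •
              Finsupp.single ((({0, 1, 2} : Finset (Fin 6))).erase i, ({3, 4, 5} : Finset (Fin 6))) (1 : L))
          + (∑ j ∈ ({3, 4, 5} : Finset (Fin 6)), (b * ε {3, 4, 5} j * v j) •
              Finsupp.single ((({3, 4, 5} : Finset (Fin 6))).erase j, ({0, 1, 2} : Finset (Fin 6))) (1 : L)) = 0) :
    v = 0 := by
  have hPN : Disjoint ({0, 1, 2} : Finset (Fin 6)) {3, 4, 5} := by decide
  have h := eq_zero_of_contract_weilClass_eq_zero hPN (by decide) (by decide) S δ hδ ε hε v lam a b ha hb h0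
  funext i
  apply h
  have : ({0, 1, 2} : Finset (Fin 6)) ∪ {3, 4, 5} = Finset.univ := by decide
  rw [this]; exact Finset.mem_univ i

end Summit.HodgeConjecture.Ring2AbelianAll.NonsplitWeilClassSupport
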